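import Literature.NumberTheory.Transcendental.RoySmallValueStep2Level
import Literature.NumberTheory.Transcendental.RoySmallValueEstimates
import Literature.NumberTheory.Transcendental.RoySmallValuePhiLength
import Literature.NumberTheory.Transcendental.RoySmallValueZeroSeparation
import Literature.NumberTheory.Transcendental.RoySmallValueStep3Separation
import HarnessLib

/-!
# Roy's small value estimate for `𝔾ₐ × 𝔾ₘ` — proof of Theorem 1.1, part A: the setting and the data of each degree

Topic `Literature/NumberTheory/Transcendental`. Part of the formalisation of the proof of Roy 2013,
Theorem 1.1 (named fact `roy2013_thm_1_1`, `RoySmallValueEstimates.lean`). Source: D. Roy,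
*A small value estimate for `𝔾ₐ × 𝔾ₘ`*, Mathematika 59 (2013) 333–363 = arXiv:1301.0663, §7,
Steps 1–2 (p. 18 of the arXiv text):

> Let the notation and hypotheses be as in Theorem 1.1. [...] We shall argue by contradiction,
> assuming on the contrary that `(1:γ)` is not a point of `ℙ²(ℚ̄)`. [...] For each positive integer
> `D`, we define a convex body `𝒞_D` [...] and denote by `P̃_D` the homogeneous polynomial [...]
> put `T = ⌊D^τ⌋`, `Y = 2D^β`, `U = D^ν/2` [...]

This file fixes the SETTING of the proof by contradiction as a record `Setting` (the parameters
and hypotheses of Theorem 1.1, the sequence `P_D` for `D ≥ D₀`, and the negation of the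
conclusion), introduces the objects attached to each degree `D` — `T_D, Y_D, U_D`, the convex body
`𝒞_D`, the form `P̃_D` (`Ptil`), its package `pkg D` (`LevelPkg`, from `nonempty_levelPkg`), the
number field `Kfld D` generated by all coordinates met up to the degree `D` and the induced
configurations — and proves the two membership statements of Step 1–2 (`𝒟ʲP̃_D ∈ 𝒞_D` for
`j < 2T_D`, `Q_D ∈ 𝒞_D`) under EXPLICIT numerical side conditions (`iterate_Ptil_mem_bodyC`,
`Q_mem_bodyC`); the side conditions are discharged asymptotically in part B. Everything is proved;
the definitions have bodies; nothing is asserted (the record `Setting` only packages hypotheses,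
and the main theorem will show it cannot be inhabited).

## References

* [Roy2013] D. Roy, *A small value estimate for 𝔾ₐ × 𝔾ₘ*, Mathematika 59 (2013), 333–363
  (arXiv:1301.0663), §7, Steps 1–2.

## Part B — Step 2 at the degree `D` (former `RoySmallValueMainB`)


Topic `Literature/NumberTheory/Transcendental`. Part of the formalisation of the proof of Roy 2013,
Theorem 1.1 (named fact `roy2013_thm_1_1`, `RoySmallValueEstimates.lean`). Source: D. Roy,
*A small value estimate for `𝔾ₐ × 𝔾ₘ`*, Mathematika 59 (2013) 333–363 = arXiv:1301.0663, §7,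
Step 2 (p. 18 of the arXiv text):

> [...] Thus, there exists a `0`-dimensional subvariety `Z = Z_D` of `ℙ²_ℚ` contained in
> `𝒵(𝒟ⁱP̃_D ; 0 ≤ i < 2T)` such that `h_{𝒞_D}(Z) ≤ −(D^δ/25)(2D^β deg(Z) + D h(Z))`. [...]
> `∑_{α∈𝒰} max{T log dist(α,(1:γ)), log dist(α,A_γ)} ≤ −(D^δ/25)(D^β deg(Z) + D h(Z))` [...]
> In particular, the set `𝒰` is not empty and contains at least one point `α₀` for which
> `log dist(α₀,(1:γ)) ≤ −D^{δ+β}/(25T)`.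

For the setting `S` (`RoySmallValueMainA`) this file introduces the remaining parameters of a
degree (`L_D`, the exponents `kexp`, `k45`, the quantity `ε_D`), the predicate `Good D`
collecting the numerical side conditions used at a degree (all of the form "an explicit
elementary function of `D` is `≤` another"; that they hold for `D ≫ 0` is part C), and carries out
Step 2 at a good degree `D` (`step2_out`): an orbit `O = Z.orb i₀` of the configuration of
`𝒵(P̃_D, Q_D)` over `K_D` with the product inequality of `step2_level`, the bound
`log Θ ≤ −κ D^δ (D^β #O + D H_O)` (`κ = 1/192`), the vanishing on `O` of the integer forms of `𝒞_D`
(`vanish`), the positivity of `dist(α_j^u, (1:γ))` on `O` (`pdist_pos`, from the non-algebraicity,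
`exists_pdist_lower_bound` of the tree, seat B), and the display quoted above (`step2_h2`,
`exists_close_point`). Everything is proved; the definitions have bodies; no named facts.

## References

* [Roy2013] D. Roy, *A small value estimate for 𝔾ₐ × 𝔾ₘ*, Mathematika 59 (2013), 333–363
  (arXiv:1301.0663), §7, Step 2.
-/

noncomputable section

open MvPolynomial Finset Filter

namespace Literature.NumberTheory.Transcendental

namespace Roy2013

open Nesterenko

/-! ### The setting of the proof by contradiction -/

/-- **The setting**: parameters and hypotheses of Theorem 1.1, the auxiliary polynomials `P_D`
(`D ≥ D₀`), and the assumption `(1:ξ:η) ∉ ℙ²(ℚ̄)` to be contradicted.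
[cite: Roy2013, Theorem 1.1 and §7 (first paragraph)] -/
structure Setting where
  /-- the point -/
  ξ : ℂ
  /-- the point -/
  η : ℂ
  /-- the exponents -/
  β : ℝ
  /-- the exponents -/
  τ : ℝ
  /-- the exponents -/
  ν : ℝ
  /-- the threshold and the polynomials -/
  D₀ : ℕ
  /-- the threshold and the polynomials -/
  P : ℕ → MvPolynomial (Fin 2) ℤ
  hη : η ≠ 0
  hτ1 : 1 ≤ τ
  hτ2 : τ < 2
  hτβ : τ < β
  hν : 2 + β - τ + (τ - 1) * (2 - τ) / (β + 1 - τ) < ν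
  hP : ∀ D, D₀ ≤ D → P D ≠ 0 ∧ (P D).totalDegree ≤ D ∧
    (mvPolyHeight (P D) : ℝ) ≤ Real.exp ((D : ℝ) ^ β) ∧
    ∀ i : ℕ, i < 3 * ⌊(D : ℝ) ^ τ⌋₊ → ‖aeval ![ξ, η] (royD^[i] (P D))‖ ≤ Real.exp (-(D : ℝ) ^ ν)
  hnot : ¬(IsAlgebraic ℚ ξ ∧ IsAlgebraic ℚ η)

namespace Setting

variable (S : Setting)

/-! ### Parameters of the degree `D` -/

/-- `T_D = ⌊D^τ⌋`. [cite: Roy2013, §7, Step 2] -/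
def T (D : ℕ) : ℕ := ⌊(D : ℝ) ^ S.τ⌋₊

/-- `Y_D = 2D^β`. [cite: Roy2013, §7, Step 2] -/
def Y (D : ℕ) : ℝ := 2 * (D : ℝ) ^ S.β

/-- `U_D = D^ν/2`. [cite: Roy2013, §7, Step 2] -/
def U (D : ℕ) : ℝ := (D : ℝ) ^ S.ν / 2

/-- `δ = ν + τ − 2 − β`. [cite: Roy2013, §7, Step 2] -/
def δ : ℝ := S.ν + S.τ - 2 - S.β

/-- The convex body `𝒞_D`. [cite: Roy2013, §7, Step 1] -/
def body (D : ℕ) : Set CX := bodyC D (S.T D) S.ξ S.η (S.Y D) (S.U D)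

/-- Basic positivity: `β > 1`, `ν > 2`, `δ > 0`. [cite: Roy2013, §7, Step 2] -/
theorem one_lt_β : 1 < S.β := lt_of_le_of_lt S.hτ1 S.hτβ

/-- `δ > (τ−1)(2−τ)/(β+1−τ) ≥ 0`. [cite: Roy2013, §7, Step 5] -/
theorem δ_lower : (S.τ - 1) * (2 - S.τ) / (S.β + 1 - S.τ) < S.δ := by
  have := S.hν; rw [δ]; linarith

/-- `δ > 0`. [cite: Roy2013, §7, Step 2] -/
theorem δ_pos : 0 < S.δ := by
  refine lt_of_le_of_lt ?_ S.δ_lower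
  have h1 : 0 ≤ S.τ - 1 := by linarith [S.hτ1]
  have h2 : 0 ≤ 2 - S.τ := by linarith [S.hτ2]
  have h3 : 0 < S.β + 1 - S.τ := by linarith [S.hτβ]
  positivity

/-- `ν > 2`. [cite: Roy2013, §7] -/
theorem two_lt_ν : 2 < S.ν := by
  have h := S.δ_pos; rw [δ] at h; linarith [S.hτβ]

/-- `Y_D > 0` for `D ≥ 1`. [folklore] -/
theorem Y_pos {D : ℕ} (hD : 1 ≤ D) : 0 < S.Y D := by
  rw [Y]; have : (0 : ℝ) < D := by exact_mod_cast hD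
  positivity

/-- `U_D ≥ 0`. [folklore] -/
theorem U_nonneg (D : ℕ) : 0 ≤ S.U D := by rw [U]; positivity

/-- `T_D ≥ D` (`τ ≥ 1`). [cite: Roy2013, §7, Step 2 ("`D ≤ T`")] -/
theorem le_T (D : ℕ) : D ≤ S.T D := by
  rw [T]
  refine Nat.le_floor ?_
  rcases Nat.eq_zero_or_pos D with rfl | hD
  · simp only [Nat.cast_zero]; positivity
  · have h1 : (1 : ℝ) ≤ D := by exact_mod_cast hD
    calc (D : ℝ) = (D : ℝ) ^ (1 : ℝ) := (Real.rpow_one _).symm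
      _ ≤ (D : ℝ) ^ S.τ := Real.rpow_le_rpow_of_exponent_le h1 S.hτ1

/-- `T_D ≤ D^τ`. [folklore] -/
theorem T_le (D : ℕ) : (S.T D : ℝ) ≤ (D : ℝ) ^ S.τ := Nat.floor_le (by positivity)

/-- `T_D ≤ D²`. [folklore] -/
theorem T_le_sq (D : ℕ) : S.T D ≤ D ^ 2 := by
  have h : (S.T D : ℝ) ≤ (D : ℝ) ^ 2 := by
    refine (S.T_le D).trans ?_
    rcases Nat.eq_zero_or_pos D with rfl | hD
    · simp [Real.zero_rpow (ne_of_gt (lt_of_lt_of_le one_pos S.hτ1))]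
    · have h1 : (1 : ℝ) ≤ D := by exact_mod_cast hD
      calc (D : ℝ) ^ S.τ ≤ (D : ℝ) ^ (2 : ℝ) := Real.rpow_le_rpow_of_exponent_le h1 S.hτ2.le
        _ = (D : ℝ) ^ 2 := by rw [Real.rpow_two]
  exact_mod_cast h

/-! ### The forms `P̃_D` and their packages -/

/-- `P̃_D` (and `0` below the threshold). [cite: Roy2013, §7, Step 1] -/
def Ptil (D : ℕ) : MvPolynomial (Fin 3) ℤ :=
  if h : S.D₀ ≤ D then royTilde D (S.hP D h).1 else 0

/-- Unfolding `P̃_D` above the threshold. [folklore] -/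
theorem Ptil_eq {D : ℕ} (h : S.D₀ ≤ D) : S.Ptil D = royTilde D (S.hP D h).1 := by
  rw [Ptil, dif_pos h]

/-- The complexification of `P̃_D`. [folklore] -/
abbrev Pc (D : ℕ) : CX := map (Int.castRingHom ℂ) (S.Ptil D)

/-- `P̃_D ∈ ℤ[X]_D`. [cite: Roy2013, §7, Step 1] -/
theorem isHomogeneous_Pc {D : ℕ} (h : S.D₀ ≤ D) : (S.Pc D).IsHomogeneous D := by
  rw [Pc, S.Ptil_eq h]; exact isHomogeneous_map_royTilde _ (S.hP D h).2.1

/-- `P̃_D ≠ 0`. [folklore] -/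
theorem Pc_ne_zero {D : ℕ} (h : S.D₀ ≤ D) : S.Pc D ≠ 0 := by
  rw [Pc, S.Ptil_eq h]; exact map_royTilde_ne_zero _

/-- `X₀ ∤ P̃_D`. [cite: Roy2013, §7, Step 1] -/
theorem not_X_zero_dvd_Pc {D : ℕ} (h : S.D₀ ≤ D) : ¬(X 0 : CX) ∣ S.Pc D := by
  rw [Pc, S.Ptil_eq h]; exact not_X_zero_dvd_royTilde _ (S.hP D h).2.1

/-- `X₂ ∤ P̃_D`. [cite: Roy2013, §7, Step 1] -/
theorem not_X_two_dvd_Pc {D : ℕ} (h : S.D₀ ≤ D) : ¬(X 2 : CX) ∣ S.Pc D := by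
  rw [Pc, S.Ptil_eq h]; exact not_X_two_dvd_royTilde _

/-- The threshold from which the packages exist. [folklore] -/
def D₁ : ℕ := max S.D₀ 1

/-- **The package of the degree `D`** (`D ≥ D₁`). [cite: Roy2013, §7, Steps 2–3] -/
def pkg (D : ℕ) (h : S.D₁ ≤ D) : LevelPkg D (S.Ptil D) :=
  Classical.choice (nonempty_levelPkg (le_trans (le_max_right _ _) h)
    (S.isHomogeneous_Pc (le_trans (le_max_left _ _) h)) (S.Pc_ne_zero (le_trans (le_max_left _ _) h))
    (S.not_X_zero_dvd_Pc (le_trans (le_max_left _ _) h))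
    (S.not_X_two_dvd_Pc (le_trans (le_max_left _ _) h)))

/-! ### The number field of the degree `D` -/

/-- All coordinates of all packages of degrees `D₁ ≤ D'' ≤ D`. [folklore] -/
def coordsUpTo (D : ℕ) : Finset ℂ :=
  (Finset.range (D + 1)).biUnion fun D'' => if h : S.D₁ ≤ D'' then (S.pkg D'' h).coords else ∅

/-- They are algebraic. [folklore] -/
theorem isAlgebraic_of_mem_coordsUpTo {D : ℕ} {x : ℂ} (hx : x ∈ S.coordsUpTo D) : IsAlgebraic ℚ x := by
  rw [coordsUpTo, mem_biUnion] at hx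
  obtain ⟨D'', -, hx⟩ := hx
  split_ifs at hx with h
  · exact (S.pkg D'' h).isAlgebraic_of_mem_coords hx
  · exact absurd hx (Finset.notMem_empty _)

/-- Coordinates of the package of `D''` are in `coordsUpTo D` for `D'' ≤ D`. [folklore] -/
theorem coords_subset {D D'' : ℕ} (h : S.D₁ ≤ D'') (hle : D'' ≤ D) (i : Fin (S.pkg D'' h).m) (k : Fin 3) :
    (S.pkg D'' h).α i k ∈ S.coordsUpTo D := by
  rw [coordsUpTo, mem_biUnion]
  refine ⟨D'', mem_range.mpr (by omega), ?_⟩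
  rw [dif_pos h]
  exact (S.pkg D'' h).mem_coords i k

/-- **The field `K_D`**: a normal number field containing every coordinate met up to `D`.
[cite: Roy2013, §2 (subvarieties over `ℚ`); construction of this development] -/
abbrev Kfld (D : ℕ) : IntermediateField ℚ ℂ := closureField (S.coordsUpTo D)

/-- Membership of the coordinates. [folklore] -/
theorem mem_Kfld {D D'' : ℕ} (h : S.D₁ ≤ D'') (hle : D'' ≤ D) :
    ∀ i k, (S.pkg D'' h).α i k ∈ S.Kfld D := fun i k =>
  mem_closureField (fun _ hx => S.isAlgebraic_of_mem_coordsUpTo hx) (S.coords_subset h hle i k)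

/-- The configuration of the degree `D''` over `K_D`. [cite: Roy2013, §7, Steps 2–3] -/
def cfgAt (D D'' : ℕ) (h : S.D₁ ≤ D'') (hle : D'' ≤ D) : ZeroConfigK (S.Kfld D) (Fin (S.pkg D'' h).m) :=
  (S.pkg D'' h).cfg (S.Kfld D) (S.mem_Kfld h hle)

/-! ### Step 1: `𝒟ʲP̃_D ∈ 𝒞_D` -/

/-- The constant `M_γ = max(1,|ξ|) · max(1,|η|⁻¹)`. [cite: Roy2013, §7, Step 1] -/
def Mγ : ℝ := max 1 ‖S.ξ‖ * max 1 ‖S.η‖⁻¹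

/-- **Step 1: norms.** `‖𝒟ʲP̃_D‖ ≤ e^{Y_D}` for `j ≤ 2T_D`, provided
`D^{2T}(D+1)² e^{D^β} ≤ e^{Y_D}`. [cite: Roy2013, §7, Step 1 ("`‖Q‖ ≤ … = exp((1+o(1))D^β)`")] -/
theorem maxNorm_iterate_Pc_le {D : ℕ} (h : S.D₀ ≤ D) (hD : 1 ≤ D)
    (hA : ((D : ℝ) ^ (2 * S.T D)) * (((D + 1) ^ 2 : ℕ) * Real.exp ((D : ℝ) ^ S.β)) ≤
      Real.exp (S.Y D))
    {j : ℕ} (hj : j ≤ 2 * S.T D) : maxNorm (homD^[j] (S.Pc D)) ≤ Real.exp (S.Y D) := by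
  have hP := S.hP D h
  have hhom := S.isHomogeneous_Pc h
  refine (maxNorm_le_l1Norm _).trans ((l1Norm_iterate_homD_le hhom j).trans (le_trans ?_ hA))
  have h1 : l1Norm (S.Pc D) ≤ ((D + 1) ^ 2 : ℕ) * Real.exp ((D : ℝ) ^ S.β) := by
    rw [Pc, S.Ptil_eq h]
    exact (l1Norm_royTilde_le _ hP.2.1).trans (mul_le_mul_of_nonneg_left hP.2.2.1 (by positivity))
  have h2 : ((D : ℝ) ^ j) ≤ (D : ℝ) ^ (2 * S.T D) := pow_le_pow_right₀ (by exact_mod_cast hD) hj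
  exact mul_le_mul h2 h1 (l1Norm_nonneg _) (by positivity)

/-- **Step 1: lengths.** `𝓛(𝒟ʲP̃_D) ≤ e^{Y_D}` for `j ≤ 2T_D` (same side condition).
[cite: Roy2013, §7, Step 1 and Step 4 ("`log‖P*‖ ≤ …`")] -/
theorem l1Norm_iterate_Pc_le {D : ℕ} (h : S.D₀ ≤ D) (hD : 1 ≤ D)
    (hA : ((D : ℝ) ^ (2 * S.T D)) * (((D + 1) ^ 2 : ℕ) * Real.exp ((D : ℝ) ^ S.β)) ≤
      Real.exp (S.Y D))
    {j : ℕ} (hj : j ≤ 2 * S.T D) : l1Norm (homD^[j] (S.Pc D)) ≤ Real.exp (S.Y D) := by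
  have hP := S.hP D h
  have hhom := S.isHomogeneous_Pc h
  refine (l1Norm_iterate_homD_le hhom j).trans (le_trans ?_ hA)
  have h1 : l1Norm (S.Pc D) ≤ ((D + 1) ^ 2 : ℕ) * Real.exp ((D : ℝ) ^ S.β) := by
    rw [Pc, S.Ptil_eq h]
    exact (l1Norm_royTilde_le _ hP.2.1).trans (mul_le_mul_of_nonneg_left hP.2.2.1 (by positivity))
  have h2 : ((D : ℝ) ^ j) ≤ (D : ℝ) ^ (2 * S.T D) := pow_le_pow_right₀ (by exact_mod_cast hD) hj
  exact mul_le_mul h2 h1 (l1Norm_nonneg _) (by positivity)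

/-- **Step 1: values.** `|𝒟ⁱ(𝒟ʲP̃_D)(1,γ)| ≤ e^{−U_D}` for `i + j < 3T_D`, provided
`(2D+1)^{3T} M_γ^{2D}·… ≤`: precisely `(2D+1)^{3T} (max(1,|ξ|)^D max(1,|η|⁻¹)^D) e^{−D^ν} ≤ e^{−U}`.
[cite: Roy2013, §7, Step 1 ("`|𝒟ⁱQ(1,γ)| ≤ … = exp(−(1−o(1))D^ν)`")] -/
theorem norm_iterate_Pc_le {D : ℕ} (h : S.D₀ ≤ D)
    (hA : (2 * D + 1 : ℝ) ^ (3 * S.T D) * (max 1 ‖S.ξ‖ ^ D * max 1 ‖S.η‖⁻¹ ^ D) *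
      Real.exp (-(D : ℝ) ^ S.ν) ≤ Real.exp (-S.U D))
    {n : ℕ} (hn : n < 3 * S.T D) :
    ‖aeval ![1, S.ξ, S.η] (homD^[n] (S.Pc D))‖ ≤ Real.exp (-S.U D) := by
  have hP := S.hP D h
  have h1 := norm_aeval_iterate_homD_royTilde_le hP.1 hP.2.1 S.hη n (W := Real.exp (-(D : ℝ) ^ S.ν))
    (fun t ht => hP.2.2.2 t (by rw [T] at hn; omega))
  rw [Pc, S.Ptil_eq h]
  refine h1.trans (le_trans ?_ hA)
  refine mul_le_mul_of_nonneg_right (mul_le_mul_of_nonneg_right ?_ (by positivity)) (Real.exp_pos _).le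
  exact pow_le_pow_right₀ (by linarith [(Nat.cast_nonneg D : (0 : ℝ) ≤ D)]) hn.le

/-- **`𝒟ʲP̃_D ∈ 𝒞_D` for `j < 2T_D`.** [cite: Roy2013, §7, Step 1 (the claim)] -/
theorem iterate_Pc_mem_body {D : ℕ} (h : S.D₀ ≤ D) (hD : 1 ≤ D)
    (hA1 : ((D : ℝ) ^ (2 * S.T D)) * (((D + 1) ^ 2 : ℕ) * Real.exp ((D : ℝ) ^ S.β)) ≤
      Real.exp (S.Y D))
    (hA2 : (2 * D + 1 : ℝ) ^ (3 * S.T D) * (max 1 ‖S.ξ‖ ^ D * max 1 ‖S.η‖⁻¹ ^ D) *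
      Real.exp (-(D : ℝ) ^ S.ν) ≤ Real.exp (-S.U D))
    {j : ℕ} (hj : j < 2 * S.T D) : homD^[j] (S.Pc D) ∈ S.body D := by
  refine ⟨isHomogeneous_iterate_homD (S.isHomogeneous_Pc h) j, S.maxNorm_iterate_Pc_le h hD hA1 hj.le,
    fun i hi => ?_⟩
  rw [← Function.iterate_add_apply]
  exact S.norm_iterate_Pc_le h hA2 (by omega)

/-! ### Step 2: `Q_D ∈ 𝒞_D` -/

/-- **`Q_D ∈ 𝒞_D`**, provided `D (D²)^D` times the bounds of Step 1 stay below `e^Y`, `e^{−U}`.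
[cite: Roy2013, §6, proof of Prop. 6.4 ("`‖Q‖ ≤ D²e^Y`") and §7, Step 2] -/
theorem Q_mem_body {D : ℕ} (h1 : S.D₁ ≤ D)
    (hA3 : (D : ℝ) * ((D : ℝ) ^ 2) ^ D * (((D : ℝ) ^ (2 * S.T D)) *
      (((D + 1) ^ 2 : ℕ) * Real.exp ((D : ℝ) ^ S.β))) ≤ Real.exp (S.Y D))
    (hA4 : (D : ℝ) * ((D : ℝ) ^ 2) ^ D * ((2 * D + 1 : ℝ) ^ (3 * S.T D) *
      (max 1 ‖S.ξ‖ ^ D * max 1 ‖S.η‖⁻¹ ^ D) * Real.exp (-(D : ℝ) ^ S.ν)) ≤ Real.exp (-S.U D)) :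
    map (Int.castRingHom ℂ) (levelQ D (S.Ptil D) (S.pkg D h1).t) ∈ S.body D := by
  have h : S.D₀ ≤ D := le_trans (le_max_left _ _) h1
  have hD1 : 1 ≤ D := le_trans (le_max_right _ _) h1
  have hP := S.hP D h
  have hhom := S.isHomogeneous_Pc h
  set t := (S.pkg D h1).t with ht
  have htD : t ≤ D ^ 2 := (S.pkg D h1).ht
  have hDT := S.le_T D
  rw [map_levelQ]
  refine ⟨isHomogeneous_map_levelQ hhom t |> fun hq => by rwa [map_levelQ] at hq, ?_, fun i hi => ?_⟩
  · -- norms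
    refine (maxNorm_le_l1Norm _).trans ?_
    refine (l1Norm_sum_le _ _).trans ?_
    have hterm : ∀ i ∈ Icc 1 D, l1Norm (((t : ℂ) ^ i) • homD^[i] (S.Pc D)) ≤
        ((D : ℝ) ^ 2) ^ D * (((D : ℝ) ^ (2 * S.T D)) * (((D + 1) ^ 2 : ℕ) * Real.exp ((D : ℝ) ^ S.β))) := by
      intro i hi
      rw [mem_Icc] at hi
      rw [smul_eq_C_mul]
      refine (l1Norm_mul_le _ _).trans ?_
      rw [l1Norm_C, norm_pow, Complex.norm_natCast]
      refine mul_le_mul ?_ ?_ (l1Norm_nonneg _) (by positivity)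
      · calc (t : ℝ) ^ i ≤ ((D : ℝ) ^ 2) ^ i := pow_le_pow_left₀ (Nat.cast_nonneg _)
              (by exact_mod_cast htD) _
          _ ≤ ((D : ℝ) ^ 2) ^ D := pow_le_pow_right₀ (one_le_pow₀ (by exact_mod_cast hD1)) hi.2
      · refine (l1Norm_iterate_homD_le hhom i).trans ?_
        have hl1 : l1Norm (S.Pc D) ≤ ((D + 1) ^ 2 : ℕ) * Real.exp ((D : ℝ) ^ S.β) := by
          rw [Pc, S.Ptil_eq h]
          exact (l1Norm_royTilde_le _ hP.2.1).trans
            (mul_le_mul_of_nonneg_left hP.2.2.1 (by positivity))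
        refine mul_le_mul (pow_le_pow_right₀ (by exact_mod_cast hD1) (by omega)) hl1
          (l1Norm_nonneg _) (by positivity)
    refine (Finset.sum_le_sum hterm).trans ?_
    rw [Finset.sum_const, Nat.card_Icc, nsmul_eq_mul, show D + 1 - 1 = D from rfl]
    linarith [hA3]
  · -- values
    rw [iterate_homD_sum, map_sum]
    refine (norm_sum_le _ _).trans ?_
    have hterm : ∀ x ∈ Icc 1 D, ‖aeval ![1, S.ξ, S.η] (homD^[i] (((t : ℂ) ^ x) • homD^[x] (S.Pc D)))‖ ≤
        ((D : ℝ) ^ 2) ^ D * ((2 * D + 1 : ℝ) ^ (3 * S.T D) *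
          (max 1 ‖S.ξ‖ ^ D * max 1 ‖S.η‖⁻¹ ^ D) * Real.exp (-(D : ℝ) ^ S.ν)) := by
      intro x hx
      rw [mem_Icc] at hx
      rw [iterate_homD_smul, map_smul, norm_smul, norm_pow, Complex.norm_natCast,
        ← Function.iterate_add_apply]
      refine mul_le_mul ?_ ?_ (norm_nonneg _) (by positivity)
      · calc (t : ℝ) ^ x ≤ ((D : ℝ) ^ 2) ^ x := pow_le_pow_left₀ (Nat.cast_nonneg _)
              (by exact_mod_cast htD) _
          _ ≤ ((D : ℝ) ^ 2) ^ D := pow_le_pow_right₀ (one_le_pow₀ (by exact_mod_cast hD1)) hx.2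
      · have hn : i + x < 3 * S.T D := by omega
        have h1 := norm_aeval_iterate_homD_royTilde_le hP.1 hP.2.1 S.hη (i + x)
          (W := Real.exp (-(D : ℝ) ^ S.ν)) (fun t' ht' => hP.2.2.2 t' (by rw [T] at hn; omega))
        rw [Pc, S.Ptil_eq h]
        refine h1.trans ?_
        refine mul_le_mul_of_nonneg_right (mul_le_mul_of_nonneg_right ?_ (by positivity))
          (Real.exp_pos _).le
        exact pow_le_pow_right₀ (by linarith [(Nat.cast_nonneg D : (0 : ℝ) ≤ D)]) hn.le
    refine (Finset.sum_le_sum hterm).trans ?_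
    rw [Finset.sum_const, Nat.card_Icc, nsmul_eq_mul, show D + 1 - 1 = D from rfl]
    linarith [hA4]

/-- **`P̃_D ∈ 𝒞_D`** (the case `j = 0`). [cite: Roy2013, §7, Step 1] -/
theorem Pc_mem_body {D : ℕ} (h1 : S.D₁ ≤ D)
    (hA1 : ((D : ℝ) ^ (2 * S.T D)) * (((D + 1) ^ 2 : ℕ) * Real.exp ((D : ℝ) ^ S.β)) ≤
      Real.exp (S.Y D))
    (hA2 : (2 * D + 1 : ℝ) ^ (3 * S.T D) * (max 1 ‖S.ξ‖ ^ D * max 1 ‖S.η‖⁻¹ ^ D) *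
      Real.exp (-(D : ℝ) ^ S.ν) ≤ Real.exp (-S.U D)) :
    S.Pc D ∈ S.body D := by
  have h : S.D₀ ≤ D := le_trans (le_max_left _ _) h1
  have hD : 1 ≤ D := le_trans (le_max_right _ _) h1
  have hT : 0 < 2 * S.T D := by have := S.le_T D; omega
  exact S.iterate_Pc_mem_body h hD hA1 hA2 (j := 0) hT

end Setting


open Nesterenko

-- `isRelPrime_of_regular` (regularity modulo `P` gives coprimality) is the tree's
-- (`RoySmallValueStep3Separation`, seat B).

namespace Setting

variable (S : Setting)

/-! ### The remaining parameters of a degree -/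

/-- Existence of `L` with `T_D ≤ binom(L+2, 2)`. [folklore] -/
theorem exists_L (D : ℕ) : ∃ L, S.T D ≤ (L + 2).choose 2 := by
  refine ⟨S.T D, ?_⟩
  calc S.T D ≤ S.T D + 1 := Nat.le_succ _
    _ = (S.T D + 1).choose 1 := (Nat.choose_one_right _).symm
    _ ≤ (S.T D + 2).choose 2 := by
        rw [show S.T D + 2 = (S.T D + 1) + 1 from rfl, Nat.choose_succ_succ]
        exact Nat.le_add_right _ _

/-- `L_D`: the least `L` with `T_D ≤ binom(L+2, 2)`. [cite: Roy2013, §6, proof of Prop. 6.1] -/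
def L (D : ℕ) : ℕ := Nat.find (S.exists_L D)

/-- `T_D ≤ binom(L_D + 2, 2)`. [folklore] -/
theorem T_le_choose (D : ℕ) : S.T D ≤ (S.L D + 2).choose 2 := Nat.find_spec (S.exists_L D)

/-- `binom(L_D + 1, 2) < T_D` (for `D ≥ 1`). [folklore] -/
theorem choose_lt_T {D : ℕ} (hD : 1 ≤ D) : (S.L D + 1).choose 2 < S.T D := by
  have hT : 1 ≤ S.T D := le_trans hD (S.le_T D)
  rcases Nat.eq_zero_or_pos (S.L D) with h0 | hpos
  · rw [h0]; simp; omega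
  · have h1 := Nat.find_min (S.exists_L D) (m := S.L D - 1) (by rw [L] at hpos ⊢; omega)
    rw [not_le] at h1
    rwa [show S.L D - 1 + 2 = S.L D + 1 by omega] at h1

/-- `kexp D`: the least `k` with `D² ≤ 2^k`. [cite: Roy2013, §2 (via `prod_norm_le_of_prod_bound`)] -/
def kexp (D : ℕ) : ℕ := Nat.find (⟨D ^ 2, (Nat.lt_two_pow_self).le⟩ : ∃ k, D ^ 2 ≤ 2 ^ k)

/-- `D² ≤ 2^{kexp D}`. [folklore] -/
theorem sq_le_two_pow (D : ℕ) : D ^ 2 ≤ 2 ^ kexp D :=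
  Nat.find_spec (⟨D ^ 2, (Nat.lt_two_pow_self).le⟩ : ∃ k, D ^ 2 ≤ 2 ^ k)

/-- Existence of `k` with `2^k T ≤ 3^k D`. [folklore] -/
theorem exists_k45 (D : ℕ) : ∃ k, 2 ^ k * S.T D ≤ 3 ^ k * D := by
  rcases Nat.eq_zero_or_pos D with rfl | hD
  · exact ⟨0, by simp [T, Real.zero_rpow (ne_of_gt (lt_of_lt_of_le one_pos S.hτ1))]⟩
  · obtain ⟨n, hn⟩ := exists_pow_lt_of_lt_one (show (0 : ℝ) < D / S.T D from
      div_pos (by exact_mod_cast hD) (by exact_mod_cast lt_of_lt_of_le hD (S.le_T D)))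
      (show (2 / 3 : ℝ) < 1 by norm_num)
    refine ⟨n, ?_⟩
    have hT : (0 : ℝ) < S.T D := by exact_mod_cast lt_of_lt_of_le hD (S.le_T D)
    have h1 : (2 : ℝ) ^ n * S.T D ≤ 3 ^ n * D := by
      rw [div_pow, div_lt_div_iff₀ (by positivity) hT] at hn
      linarith
    exact_mod_cast h1

/-- `k45 D`: the least `k` with `2^k T_D ≤ 3^k D`. [cite: Roy2013, Proposition 4.5 (the parameter `k`)] -/
def k45 (D : ℕ) : ℕ := Nat.find (S.exists_k45 D)

/-- `2^{k45} T_D ≤ 3^{k45} D`. [folklore] -/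
theorem k45_spec (D : ℕ) : 2 ^ S.k45 D * S.T D ≤ 3 ^ S.k45 D * D := Nat.find_spec (S.exists_k45 D)

/-- `N_D = binom(3D+2, 2)`, the number of rows of `Φ`. [cite: Roy2013, §5] -/
abbrev Nrow (D : ℕ) : ℕ := (3 * D + 2).choose 2

/-- `ε_D = 2^{2k2^k} e^{−TU} N!(3e^Y)^N`. [cite: Roy2013, §7, Step 2] -/
def εlev (D : ℕ) : ℝ :=
  (2 : ℝ) ^ (2 * kexp D * 2 ^ kexp D) * (Real.exp (-(S.T D * S.U D)) *
    ((Nrow D).factorial * (3 * Real.exp (S.Y D)) ^ Nrow D))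

/-- `ε_D > 0`. [folklore] -/
theorem εlev_pos (D : ℕ) : 0 < S.εlev D := by
  rw [εlev]
  exact mul_pos (pow_pos two_pos _) (mul_pos (Real.exp_pos _) (mul_pos
    (by exact_mod_cast Nat.factorial_pos _) (pow_pos (mul_pos three_pos (Real.exp_pos _)) _)))

/-- `κ = 1/192`. [cite: Roy2013, §7, Step 2 (`D^δ/25`), here `D^δ/192`] -/
def κ : ℝ := 1 / 192

/-! ### The numerical side conditions at a degree -/

/-- **The side conditions at the degree `E`** ("if `D` is large enough"). See part C for their
asymptotic validity. [cite: Roy2013, §7 ("assuming that `D` is sufficiently large")] -/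
structure Good (E : ℕ) : Prop where
  hD₁ : S.D₁ ≤ E
  two_le : 2 ≤ E
  hA1 : ((E : ℝ) ^ (2 * S.T E)) * (((E + 1) ^ 2 : ℕ) * Real.exp ((E : ℝ) ^ S.β)) ≤ Real.exp (S.Y E)
  hA2 : (2 * E + 1 : ℝ) ^ (3 * S.T E) * (max 1 ‖S.ξ‖ ^ E * max 1 ‖S.η‖⁻¹ ^ E) *
    Real.exp (-(E : ℝ) ^ S.ν) ≤ Real.exp (-S.U E)
  hA3 : (E : ℝ) * ((E : ℝ) ^ 2) ^ E * (((E : ℝ) ^ (2 * S.T E)) *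
    (((E + 1) ^ 2 : ℕ) * Real.exp ((E : ℝ) ^ S.β))) ≤ Real.exp (S.Y E)
  hA4 : (E : ℝ) * ((E : ℝ) ^ 2) ^ E * ((2 * E + 1 : ℝ) ^ (3 * S.T E) *
    (max 1 ‖S.ξ‖ ^ E * max 1 ‖S.η‖⁻¹ ^ E) * Real.exp (-(E : ℝ) ^ S.ν)) ≤ Real.exp (-S.U E)
  hL : 3 * (S.L E + 1) ≤ E
  hYc : (3 * (1 + ‖S.ξ‖ + ‖S.η‖⁻¹)) ^ S.L E * (4 * (S.L E + 1) : ℝ) ^ (S.L E + 2).choose 2 ≤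
    Real.exp (S.Y E)
  hε : S.εlev E ≤ Real.exp (-(S.T E * S.U E) / 2)
  hfact : Real.log ((Nrow E).factorial) ≤ 2 * (E : ℝ) ^ (2 + S.β)
  hchoose : ((2 * E + 2).choose 2 : ℝ) ≤ 5 * (E : ℝ) ^ 2
  herr : errStep2 S.ξ S.η (S.T E) (S.k45 E) ≤ κ / 2 * (E : ℝ) ^ S.δ * (E : ℝ) ^ S.β
  hTτ : (E : ℝ) ^ S.τ ≤ 2 * S.T E
  hstep4 : Real.log 2 + 2 * roy_c2 S.ξ S.η ^ 2 +
    (44 * (2 : ℝ) ^ (1 + S.β - S.τ) + 16) * (E : ℝ) ^ (2 + S.β - S.τ) ≤ S.U E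
  hE₄ : Real.log 4 + S.Y E + E * Real.log (roy_c4 S.ξ S.η) ≤ 3 * (E : ℝ) ^ S.β

/-! ### Consequences of `Good` -/

namespace Good

variable {S} {E : ℕ} (hG : S.Good E)
include hG

/-- `D₀ ≤ E`. [folklore] -/
theorem hD₀ : S.D₀ ≤ E := le_trans (le_max_left _ _) hG.hD₁

/-- `1 ≤ E`. [folklore] -/
theorem one_le : 1 ≤ E := le_trans one_le_two hG.two_le

/-- `L_E ≤ E` and `L_E < E`. [folklore] -/
theorem L_lt : S.L E < E := by have := hG.hL; omega

/-- `1 ≤ T_E`. [folklore] -/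
theorem one_le_T : 1 ≤ S.T E := le_trans hG.one_le (S.le_T E)

/-- `T_E U_E ≥ E^{2+β+δ}/4`. [cite: Roy2013, §7, Step 2 ("`TU = CD²Y`")] -/
theorem TU_lower : (E : ℝ) ^ (2 + S.β) * (E : ℝ) ^ S.δ / 4 ≤ S.T E * S.U E := by
  have hE : (0 : ℝ) < E := by exact_mod_cast lt_of_lt_of_le one_pos hG.one_le
  have h1 : (E : ℝ) ^ (2 + S.β) * (E : ℝ) ^ S.δ = (E : ℝ) ^ S.τ * (E : ℝ) ^ S.ν := by
    rw [← Real.rpow_add hE, ← Real.rpow_add hE]; congr 1; rw [Setting.δ]; ring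
  rw [h1, Setting.U]
  have h2 := hG.hTτ
  have h3 : (0 : ℝ) ≤ (E : ℝ) ^ S.ν := by positivity
  nlinarith

/-- `ε_E < 1`. [folklore] -/
theorem ε_lt_one : S.εlev E < 1 := by
  refine lt_of_le_of_lt hG.hε ?_
  rw [Real.exp_lt_one_iff]
  have h1 : (0 : ℝ) < S.T E := by exact_mod_cast hG.one_le_T
  have h2 : (0 : ℝ) < S.U E := by
    rw [Setting.U]; have : (0 : ℝ) < E := by exact_mod_cast hG.one_le
    positivity
  have := mul_pos h1 h2
  linarith

/-- `log ε_E ≤ −T_E U_E / 2`. [folklore] -/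
theorem log_ε_le : Real.log (S.εlev E) ≤ -(S.T E * S.U E) / 2 := by
  have h := Real.log_le_log (S.εlev_pos E) hG.hε
  rwa [Real.log_exp] at h

end Good

/-! ### The objects of Step 2 at a good degree -/

/-- The configuration of the degree `D` over `K_D`. [cite: Roy2013, §7, Step 2] -/
abbrev Zc (D : ℕ) (h : S.D₁ ≤ D) : ZeroConfigK (S.Kfld D) (Fin (S.pkg D h).m) := S.cfgAt D D h le_rfl

/-- The weight `w_O = ∑_{j∈O} (Y + D h_j)` of the orbit of `i₀`. [cite: Roy2013, Prop. 6.2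
("`Y deg(Z) + D h(Z)`")] -/
def wO (D : ℕ) (h : S.D₁ ≤ D) (i₀ : Fin (S.pkg D h).m) : ℝ :=
  ∑ j ∈ (S.Zc D h).orb i₀, (S.Y D + D * hgtK (S.Zc D h) j)

/-- The total weight `B_w = ∑_j e_j (Y + D h_j)`. [cite: Roy2013, Prop. 6.2] -/
def Bw (D : ℕ) (h : S.D₁ ≤ D) : ℝ :=
  ∑ j, ((S.pkg D h).e j : ℝ) * (S.Y D + D * hgtK (S.Zc D h) j)

/-- The bound `Θ = ε^{w_O/B_w}` of the orbit product. [cite: Roy2013, §7, Step 2] -/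
def Θ (D : ℕ) (h : S.D₁ ≤ D) (i₀ : Fin (S.pkg D h).m) : ℝ := S.εlev D ^ (S.wO D h i₀ / S.Bw D h)

/-- `#M₁ ≤ binom(2D+2, 2)`. [folklore] -/
theorem card_M₁_le {D : ℕ} (h : S.D₁ ≤ D) : ((S.pkg D h).M₁.card : ℝ) ≤ (2 * D + 2).choose 2 := by
  have 𝓛 := S.pkg D h
  haveI := NguyenRoy.finiteDimensional_homogeneousSubmodule (K := ℂ) (σ := Fin 3) (2 * D)
  have h1 : Module.finrank ℂ (Submodule.span ℂ ((fun μ => monomial μ (1 : ℂ)) ''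
      ((S.pkg D h).M₁ : Set (Fin 3 →₀ ℕ)))) ≤ Module.finrank ℂ (homogeneousSubmodule (Fin 3) ℂ (2 * D)) := by
    apply Submodule.finrank_mono
    rw [← (S.pkg D h).hE₁s]
    exact le_sup_left
  rw [finrank_span_monomials, finrank_homogeneousSubmodule_fin_three] at h1
  exact_mod_cast h1

/-- **`log 𝓛(F_D) ≤ 22 D^{2+β}`** for `F_D = Φ(P̃_D, Q_D, ·)`, at a good degree.
[cite: Roy2013, §6, proof of Prop. 6.4 ("`‖F‖ ≤ N!‖P‖^N‖Q‖^N ≤ exp(6D²Y)`")] -/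
theorem log_l1Norm_royF_le {D : ℕ} (hG : S.Good D) :
    Real.log (l1Norm (royF D (S.pkg D hG.hD₁).M₁ (S.pkg D hG.hD₁).M₂ (S.pkg D hG.hD₁).σ (S.Pc D)
      (map (Int.castRingHom ℂ) (levelQ D (S.Ptil D) (S.pkg D hG.hD₁).t)))) ≤
      22 * (D : ℝ) ^ (2 + S.β) := by
  set 𝓛 := S.pkg D hG.hD₁ with h𝓛
  have hP := S.Pc_mem_body hG.hD₁ hG.hA1 hG.hA2
  have hQ := S.Q_mem_body hG.hD₁ hG.hA3 hG.hA4
  have hD : (1 : ℝ) ≤ D := by exact_mod_cast hG.one_le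
  have hD0 : (0 : ℝ) < D := by linarith
  -- the length bound, with plain exponents
  have h1 : l1Norm (royF D 𝓛.M₁ 𝓛.M₂ 𝓛.σ (S.Pc D) (map (Int.castRingHom ℂ) (levelQ D (S.Ptil D) 𝓛.t))) ≤
      (Nrow D).factorial * (maxNorm (S.Pc D) ^ ((2 * D + 2).choose 2) *
        maxNorm (map (Int.castRingHom ℂ) (levelQ D (S.Ptil D) 𝓛.t)) ^ 𝓛.M₁.card) := by
    have h := l1Norm_royF_le 𝓛.σ (S.Pc D) (map (Int.castRingHom ℂ) (levelQ D (S.Ptil D) 𝓛.t))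
    have hc2 : (univ.finsuppAntidiag (2 * D) : Finset (Fin 3 →₀ ℕ)).card = (2 * D + 2).choose 2 := by
      rw [← Fintype.card_coe]; exact card_finsuppAntidiag_fin_three (2 * D)
    rw [card_finsuppAntidiag_fin_three] at h
    simp only [Fintype.card_coe] at h
    rw [hc2] at h
    exact h
  have hN0 : ((2 * D + 2).choose 2 : ℝ) ≤ 5 * (D : ℝ) ^ 2 := hG.hchoose
  have hN1 : (𝓛.M₁.card : ℝ) ≤ 5 * (D : ℝ) ^ 2 := (S.card_M₁_le hG.hD₁).trans hG.hchoose
  have hmP : maxNorm (S.Pc D) ≤ Real.exp (S.Y D) := hP.2.1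
  have hmQ : maxNorm (map (Int.castRingHom ℂ) (levelQ D (S.Ptil D) 𝓛.t)) ≤ Real.exp (S.Y D) := hQ.2.1
  have hpos : 0 < l1Norm (royF D 𝓛.M₁ 𝓛.M₂ 𝓛.σ (S.Pc D)
      (map (Int.castRingHom ℂ) (levelQ D (S.Ptil D) 𝓛.t))) := by
    rw [l1Norm]
    have hne : royF D 𝓛.M₁ 𝓛.M₂ 𝓛.σ (S.Pc D) (map (Int.castRingHom ℂ) (levelQ D (S.Ptil D) 𝓛.t)) ≠ 0 := by
      rw [show S.Pc D = map (Int.castRingHom ℂ) (S.Ptil D) from rfl, 𝓛.hFeq]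
      exact mul_ne_zero (C_ne_zero.mpr 𝓛.hc) (prod_ne_zero_iff.mpr fun i _ =>
        pow_ne_zero _ (evalForm_ne_zero (𝓛.α_ne_zero i)))
    obtain ⟨mo, hmo⟩ := support_nonempty.mpr hne
    exact Finset.sum_pos' (fun _ _ => norm_nonneg _) ⟨mo, hmo, norm_pos_iff.mpr (mem_support_iff.mp hmo)⟩
  set N₀ := (2 * D + 2).choose 2 with hN₀def
  set N₁ := 𝓛.M₁.card with hN₁def
  have heY : 0 < Real.exp (S.Y D) := Real.exp_pos _
  have h2 : l1Norm (royF D 𝓛.M₁ 𝓛.M₂ 𝓛.σ (S.Pc D) (map (Int.castRingHom ℂ) (levelQ D (S.Ptil D) 𝓛.t))) ≤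
      (Nrow D).factorial * (Real.exp (S.Y D) ^ N₀ * Real.exp (S.Y D) ^ N₁) := by
    refine h1.trans (mul_le_mul_of_nonneg_left ?_ (Nat.cast_nonneg _))
    exact mul_le_mul (pow_le_pow_left₀ (maxNorm_nonneg _) hmP _)
      (pow_le_pow_left₀ (maxNorm_nonneg _) hmQ _) (pow_nonneg (maxNorm_nonneg _) _)
      (pow_nonneg heY.le _)
  have hfpos : (0 : ℝ) < (Nrow D).factorial := by exact_mod_cast Nat.factorial_pos _
  calc Real.log (l1Norm (royF D 𝓛.M₁ 𝓛.M₂ 𝓛.σ (S.Pc D) (map (Int.castRingHom ℂ) (levelQ D (S.Ptil D) 𝓛.t))))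
      ≤ Real.log ((Nrow D).factorial * (Real.exp (S.Y D) ^ N₀ * Real.exp (S.Y D) ^ N₁)) :=
        Real.log_le_log hpos h2
    _ = Real.log ((Nrow D).factorial) + (N₀ + N₁) * S.Y D := by
        rw [Real.log_mul hfpos.ne' (mul_pos (pow_pos heY _) (pow_pos heY _)).ne',
          Real.log_mul (pow_pos heY _).ne' (pow_pos heY _).ne', Real.log_pow, Real.log_pow,
          Real.log_exp]; ring
    _ ≤ 2 * (D : ℝ) ^ (2 + S.β) + (5 * (D : ℝ) ^ 2 + 5 * (D : ℝ) ^ 2) * (2 * (D : ℝ) ^ S.β) := by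
        have hY : 0 ≤ (D : ℝ) ^ S.β := by positivity
        have hf := hG.hfact
        have hNN : (N₀ : ℝ) + N₁ ≤ 5 * (D : ℝ) ^ 2 + 5 * (D : ℝ) ^ 2 := add_le_add hN0 hN1
        rw [Setting.Y]
        nlinarith
    _ = 22 * (D : ℝ) ^ (2 + S.β) := by
        rw [Real.rpow_add hD0, Real.rpow_two]; ring

/-- **`B_w ≤ 24 D^{2+β}`.** [cite: Roy2013, Prop. 6.2 (proof: "`h(Z') ≤ … ≤ 3Y`")] -/
theorem Bw_le {D : ℕ} (hG : S.Good D) : S.Bw D hG.hD₁ ≤ 24 * (D : ℝ) ^ (2 + S.β) := by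
  set 𝓛 := S.pkg D hG.hD₁ with h𝓛
  have hD0 : (0 : ℝ) < D := by exact_mod_cast lt_of_lt_of_le one_pos hG.one_le
  have h1 : S.Bw D hG.hD₁ = S.Y D * (∑ j, (𝓛.e j : ℝ)) + D * ∑ j, (𝓛.e j : ℝ) * hgtK (S.Zc D hG.hD₁) j := by
    rw [Setting.Bw, Finset.mul_sum, Finset.mul_sum, ← Finset.sum_add_distrib]
    exact Finset.sum_congr rfl fun j _ => by ring
  have h2 : (∑ j, (𝓛.e j : ℝ)) = (D : ℝ) ^ 2 := by
    have := 𝓛.hesum; rw [𝓛.hcard] at this; exact_mod_cast this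
  have h3 := sum_mul_hgtK_le_log_l1Norm (S.Zc D hG.hD₁) 𝓛.σ (P := S.Pc D)
    (Q := map (Int.castRingHom ℂ) (levelQ D (S.Ptil D) 𝓛.t))
    (map_royF 𝓛.σ (Int.castRingHom ℂ) (S.Ptil D) (levelQ D (S.Ptil D) 𝓛.t)) 𝓛.hc 𝓛.hFeq
  have h4 := S.log_l1Norm_royF_le hG
  rw [h1, h2, Setting.Y]
  have h5 : (D : ℝ) ^ S.β * (D : ℝ) ^ 2 = (D : ℝ) ^ (2 + S.β) := by
    rw [Real.rpow_add hD0, Real.rpow_two]; ring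
  nlinarith

/-- `B_w > 0`. [folklore] -/
theorem Bw_pos {D : ℕ} (hG : S.Good D) : 0 < S.Bw D hG.hD₁ := by
  set 𝓛 := S.pkg D hG.hD₁ with h𝓛
  haveI : Nonempty (Fin 𝓛.m) := ⟨⟨0, 𝓛.m_pos hG.one_le⟩⟩
  rw [Setting.Bw]
  refine Finset.sum_pos (fun j _ => mul_pos (by exact_mod_cast 𝓛.he1 j) ?_) univ_nonempty
  have := hgtK_nonneg (S.Zc D hG.hD₁) j
  have := S.Y_pos hG.one_le
  positivity

/-- `w_O ≥ 0`, indeed `w_O ≥ Y #O`. [folklore] -/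
theorem wO_nonneg {D : ℕ} (hG : S.Good D) (i₀ : Fin (S.pkg D hG.hD₁).m) : 0 ≤ S.wO D hG.hD₁ i₀ := by
  rw [Setting.wO]
  refine Finset.sum_nonneg fun j _ => ?_
  have := hgtK_nonneg (S.Zc D hG.hD₁) j
  have := S.Y_pos hG.one_le
  positivity

/-- **`log Θ ≤ −κ D^δ (D^β #O + D H_O)`.** [cite: Roy2013, §7, Step 2
("`h_{𝒞_D}(Z) ≤ −(D^δ/25)(2D^β deg(Z) + D h(Z))`")] -/
theorem log_Θ_le {D : ℕ} (hG : S.Good D) (i₀ : Fin (S.pkg D hG.hD₁).m) :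
    Real.log (S.Θ D hG.hD₁ i₀) ≤ -(κ * (D : ℝ) ^ S.δ *
      ((D : ℝ) ^ S.β * ((S.Zc D hG.hD₁).orb i₀).card + D * ∑ j ∈ (S.Zc D hG.hD₁).orb i₀,
        hgtK (S.Zc D hG.hD₁) j)) := by
  have hε := S.εlev_pos D
  have hBw := S.Bw_pos hG
  have hBwle := S.Bw_le hG
  have hw := S.wO_nonneg hG i₀
  have hlogε := hG.log_ε_le
  have hTU := hG.TU_lower
  have hD0 : (0 : ℝ) < D := by exact_mod_cast lt_of_lt_of_le one_pos hG.one_le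
  rw [Setting.Θ, Real.log_rpow hε]
  -- `(w/B_w) log ε ≤ (w / (24 D^{2+β})) (−TU/2)`
  have h1 : S.wO D hG.hD₁ i₀ / S.Bw D hG.hD₁ * Real.log (S.εlev D) ≤
      S.wO D hG.hD₁ i₀ / (24 * (D : ℝ) ^ (2 + S.β)) * (-(S.T D * S.U D) / 2) := by
    have h2 : S.wO D hG.hD₁ i₀ / S.Bw D hG.hD₁ * Real.log (S.εlev D) ≤
        S.wO D hG.hD₁ i₀ / S.Bw D hG.hD₁ * (-(S.T D * S.U D) / 2) :=
      mul_le_mul_of_nonneg_left hlogε (div_nonneg hw hBw.le)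
    refine h2.trans ?_
    have hneg : -(S.T D * S.U D) / 2 ≤ 0 := by linarith [hTU, show (0:ℝ) ≤ (D : ℝ) ^ (2 + S.β) * (D : ℝ) ^ S.δ / 4 by positivity]
    have h3 : S.wO D hG.hD₁ i₀ / (24 * (D : ℝ) ^ (2 + S.β)) ≤ S.wO D hG.hD₁ i₀ / S.Bw D hG.hD₁ :=
      div_le_div_of_nonneg_left hw hBw hBwle
    exact mul_le_mul_of_nonpos_right h3 hneg
  refine h1.trans ?_
  -- evaluate
  have h4 : S.wO D hG.hD₁ i₀ = 2 * (D : ℝ) ^ S.β * ((S.Zc D hG.hD₁).orb i₀).card +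
      D * ∑ j ∈ (S.Zc D hG.hD₁).orb i₀, hgtK (S.Zc D hG.hD₁) j := by
    rw [Setting.wO, Finset.sum_add_distrib, Finset.sum_const, nsmul_eq_mul, Finset.mul_sum, Setting.Y]; ring
  have hpos1 : 0 < 24 * (D : ℝ) ^ (2 + S.β) := by positivity
  rw [div_mul_eq_mul_div, div_le_iff₀ hpos1, h4, Setting.κ]
  have hsum : 0 ≤ ∑ j ∈ (S.Zc D hG.hD₁).orb i₀, hgtK (S.Zc D hG.hD₁) j :=
    Finset.sum_nonneg fun j _ => hgtK_nonneg _ j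
  have hb : 0 ≤ (D : ℝ) ^ S.β := by positivity
  have hd : 0 ≤ (D : ℝ) ^ S.δ := by positivity
  have hcard : (0 : ℝ) ≤ ((S.Zc D hG.hD₁).orb i₀).card := Nat.cast_nonneg _
  nlinarith [mul_nonneg hb hcard, mul_nonneg hD0.le hsum, mul_nonneg hd (mul_nonneg hb hcard),
    mul_nonneg hd (mul_nonneg hD0.le hsum)]

end Setting


end Roy2013

end Literature.NumberTheory.Transcendental
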